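import Literature.NumberTheory.Rogawski1990.ArchEndoscopicTransferCompatible       -- ★ the letter `ArchEndoscopicTransferCompatible` (node N3) + ★ `ArchCompatibleFamiliesG∕H`
import Literature.NumberTheory.Rogawski1990.ArchCentralValueTransferDiagonal        -- ★ precedent (F0P3-p03 (g9)): `exists_formCongr_eq_diagonal`; brings ★ `ArchCentralValueTransferCongruence` (`TransferFactorData.comap_symm_comap`), ★ `ArchWeilDataCongruence` ((W′)(C′)(C′G) carried), ★ `ArchCongruenceTransport`
import Literature.NumberTheory.Rogawski1990.ArchExplicitTransferFactorCongruence   -- ★ `archExplicitDelta_archCongr` (Δ″_∞ is a congruence invariant); brings ★ FILE 5 `ArchDeltaTransferCongruence` (`isArchDeltaTransfer_comap_iff`) and ★ `archExplicitTransferFactor`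
import Literature.NumberTheory.Rogawski1990.ArchSmoothCongruence                   -- ★ `ArchSmooth.comp_archCongr_symm`
import HarnessLib

/-!
# The archimedean endoscopic transfer letter for the EXPLICIT factor `Δ″_∞`, on EVERY anisotropic hermitian form, from the same letter on DIAGONAL forms —
# the frame transport of the LH3 direct road to `stub_N9` (Rogawski 1990 §14.3 pp. 233–234, §14.4 p. 237, §4.3 p. 43, §1.7 p. 6; Platonov–Rapinchuk §2.3)

Topic `NumberTheory/Rogawski1990`; namespace `Literature.NumberTheory.Rogawski1990`.  THEOREMS ONLY over accepted tree modules (no definition, no instance, no notation,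
no named fact, no `sorry`).  Cell `pub/hodgecm-mathlib`, line LH3 (closer stub `stub_N9` — archimedean endoscopic transfer — of `Cruxes/H413/Lines/F0_U3LettersRung1.lean`,
crux H413 = `stmt-HodgeConjecture-24833`): organ **(N9-DIAG)** «frame transport to the diagonal form» (LH3-plan (g2) 2026-09-02T05:49:22Z; author LH7-p02 (g2)).
WHY: every in-house brick of the direct road (the Cayley-frame `Δ″_∞`∕κ-table, the Cartan atlas `gprimeTorus`, (W1)) lives on the DIAGONAL frame
`G′_∞ = U(diag α)(L⁺ ⊗ ℝ)`, while the closer's `stub_N9` quantifies over EVERY hermitian anisotropic `H`; the pay-down skeleton proves `stub_N9`'s body at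
`H := diagonal α` and needs ONE theorem carrying it to all `H` — this file, the exact analogue of the (S-d) precedent ★ `archCentralValueTransferExists_canonical_of_diagonal`.

THE ROAD (all ★).  A rational diagonalising frame `ᵗ(c̄P) H P = diagonal α` (★ `exists_formCongr_eq_diagonal`); the arch congruence
`Ψ : U(ᵗc̄P H P)(L ⊗ ℝ) ≃ₜ* U(H)(L ⊗ ℝ)`, `g ↦ (P ⊗ 1) g (P ⊗ 1)⁻¹` (★ `unitaryGroupOfFormCongrOfEq`, ★ `coe_archCongr_apply`∕`coe_archCongr_symm_apply`) and its inverse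
`Φ := Ψ⁻¹` as the ABSTRACT FRAME `(T := (P ⊗ 1)⁻¹, Φ, hΦ)` of the ★ (T-d) files.  §1: a compatible system `(m′, m, t′, t)` on `(U(H₂), U(Φ₃))` (★ `ArchCompatibleFamiliesG`:
(W′)(W) Weil form, (C′)(C)(C′G) coherence) is PUSHED along any frame `Φ : U(H₂) ≃ₜ* U(H)` to `(Φ_* m′, m, t′^Φ, t)` on `(U(H), U(Φ₃))` — (W′) by ★ `isQuotientOf_transport_archCongr`,
(C′) by ★ `map_archStableCentralizerEquiv_torusPush_eq`, (C′G) by ★ `map_archStableCentralizerEquiv_torusPush_eq_of_cross` (the canonical centraliser isomorphisms are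
natural under `Φ`, ★ p841403), (W)(C) untouched; the `H_∞`-half (★ `ArchCompatibleFamiliesH`) does not move.  §2: hence the letter ★ `ArchEndoscopicTransferCompatible` KNOWN on
the target `U(H)` for the pushed factor `T₂^Φ = T₂ ∘ (id × Φ⁻¹)` and the pushed Haar measure `Φ_* ν₂` gives it on the source `U(H₂)` for `(T₂, ν₂)`: push the given system (§1), take
the target's transfer `a^H` of `a₂ ∘ Φ⁻¹ ∈ C_c^∞(U(H))` (★ `ArchSmooth.comp_archCongr_symm`), and read (4.3.1) back through ★ `isArchDeltaTransfer_comap_iff` («`f′_v → f′^H_v` is defined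
via `f_v = f′_v ∘ ψ_v⁻¹`», §14.4 p. 237) and the factor round trip ★ `TransferFactorData.comap_symm_comap`.  §3: for the EXPLICIT factor `Δ″_∞` (★ `archExplicitTransferFactor`) the
pushed factor of `Δ″^{H}` IS `Δ″^{ᵗc̄PHP}` (★ `archExplicitDelta_archCongr`: `Δ″` is a congruence invariant — `τ`, `D_{G∕H}` see only `γ_H`, the `κ_w` are sign-of-trace congruence
invariants), the two invariances `hl`, `hr` of the congruent form follow from those of `H`, the guards transport (★ `transpose_map_formCongr_cm`, ★ `anisotropic_formCongr_cm`),
and the HEAD **`archEndoscopicTransferCompatible_explicit_of_diagonal`** states `stub_N9`'s sentence VERBATIM (binders of `Cruxes/H413/Lines/F0_P3c_StubN9Paydown.lean`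
`stub_N9_paid`, carriers expanded) from the same sentence restricted to diagonal `H₂`.
JUNCTION for the skeleton: `stub_N9_paid := archEndoscopicTransferCompatible_explicit_of_diagonal stub_N9_diagonal`.  HONEST LABEL: HC_CM is proved only modulo the 7 printed
citations (2 remaining: hLiu418 = stmt-HodgeConjecture-24832, h413 = stmt-HodgeConjecture-24833) until rung 0 closes; this file is count-neutral bookkeeping (it moves the letter
between congruent frames and proves no transfer).

## References
* [Rogawski1990] J. D. Rogawski, *Automorphic Representations of Unitary Groups in Three Variables*, Ann. of Math. Stud. 123 (1990), §14.3 pp. 233–234 (the transfer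
  `f′_∞ → f′^H_∞`), §14.4 p. 237 («`Δ″_v = Δ_v ∘ ψ_v`, `f_v = f′_v ∘ ψ_v⁻¹`»), §14.1 p. 232 (inner forms, congruent hermitian forms), §4.3 (4.3.1) p. 43, §1.7 p. 6 (compatible measures).
* [Shelstad1979] D. Shelstad, *Characters and inner forms of a quasi-split group over ℝ*, Compositio Math. 39 (1979), §4 p. 20 (transport of `dt` along the inner twist).
* [PlatonovRapinchuk1994] V. Platonov, A. Rapinchuk, *Algebraic Groups and Number Theory* (1994), §2.3 (unitary groups of congruent forms are conjugate in `GL_N`).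
* [Landherr1936HermitianForms] W. Landherr (1936) (diagonalisation of hermitian forms over number fields).
-/

set_option autoImplicit false

noncomputable section

open MeasureTheory Measure NumberField NumberField.InfinitePlace NumberField.mixedEmbedding IsDedekindDomain
open Literature.MeasureTheory.Group

namespace Literature.NumberTheory.Rogawski1990

open Literature.NumberTheory.Automorphic Literature.NumberTheory.GaloisRepresentations
open Literature.AlgebraicGeometry.ShimuraVarieties (unitaryGroup hermForm)
open scoped Matrix ComplexOrder MatrixGroups

/-! ## §1–§2 Along an abstract congruence `Φ : U(H₂)(L ⊗ ℝ) ≃ₜ* U(H)(L ⊗ ℝ)`, `Φ g = T g T⁻¹` -/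

section Transport

variable (L : Type) [Field L] [NumberField L] [IsCMField L] {H H₂ : Matrix (Fin 3) (Fin 3) L} (T : GL (Fin 3) (mixedSpace L))
  (Φ : UnitaryGroup.arch (↥(maximalRealSubfield L)) L (IsCMField.complexConj L) 3 H₂ ≃ₜ* UnitaryGroup.arch (↥(maximalRealSubfield L)) L (IsCMField.complexConj L) 3 H)
  (hΦ : ∀ g : UnitaryGroup.arch (↥(maximalRealSubfield L)) L (IsCMField.complexConj L) 3 H₂, ((Φ g : UnitaryGroup.arch (↥(maximalRealSubfield L)) L (IsCMField.complexConj L) 3 H) : GL (Fin 3) (mixedSpace L)) = T * (g : GL (Fin 3) (mixedSpace L)) * T⁻¹)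
  [MeasurableSpace (UnitaryGroup.arch (↥(maximalRealSubfield L)) L (IsCMField.complexConj L) 3 H₂)] [BorelSpace (UnitaryGroup.arch (↥(maximalRealSubfield L)) L (IsCMField.complexConj L) 3 H₂)]
  [MeasurableSpace (UnitaryGroup.arch (↥(maximalRealSubfield L)) L (IsCMField.complexConj L) 3 H)] [BorelSpace (UnitaryGroup.arch (↥(maximalRealSubfield L)) L (IsCMField.complexConj L) 3 H)]
  [MeasurableSpace (UnitaryGroup.arch (↥(maximalRealSubfield L)) L (IsCMField.complexConj L) 3 (Matrix.of fun i j : Fin 3 => if i.val + j.val + 1 = 3 then (1 : L) else 0))] [BorelSpace (UnitaryGroup.arch (↥(maximalRealSubfield L)) L (IsCMField.complexConj L) 3 (Matrix.of fun i j : Fin 3 => if i.val + j.val + 1 = 3 then (1 : L) else 0))]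
  [MeasurableSpace (UnitaryGroup.arch (↥(maximalRealSubfield L)) L (IsCMField.complexConj L) 2 (Matrix.of fun i j : Fin 2 => if i.val + j.val + 1 = 2 then (1 : L) else 0) × UnitaryGroup.arch (↥(maximalRealSubfield L)) L (IsCMField.complexConj L) 1 (Matrix.of fun i j : Fin 1 => if i.val + j.val + 1 = 1 then (1 : L) else 0))] [BorelSpace (UnitaryGroup.arch (↥(maximalRealSubfield L)) L (IsCMField.complexConj L) 2 (Matrix.of fun i j : Fin 2 => if i.val + j.val + 1 = 2 then (1 : L) else 0) × UnitaryGroup.arch (↥(maximalRealSubfield L)) L (IsCMField.complexConj L) 1 (Matrix.of fun i j : Fin 1 => if i.val + j.val + 1 = 1 then (1 : L) else 0))]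
  (ν₂ : Measure (UnitaryGroup.arch (↥(maximalRealSubfield L)) L (IsCMField.complexConj L) 3 H₂)) [ν₂.IsHaarMeasure] [ν₂.IsMulRightInvariant]
  (νt : Measure (UnitaryGroup.arch (↥(maximalRealSubfield L)) L (IsCMField.complexConj L) 3 H)) [νt.IsHaarMeasure] [νt.IsMulRightInvariant] (hνt : νt = ν₂.map Φ)
  (ν : Measure (UnitaryGroup.arch (↥(maximalRealSubfield L)) L (IsCMField.complexConj L) 3 (Matrix.of fun i j : Fin 3 => if i.val + j.val + 1 = 3 then (1 : L) else 0))) [ν.IsHaarMeasure] [ν.IsMulRightInvariant]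
  (νH : Measure (UnitaryGroup.arch (↥(maximalRealSubfield L)) L (IsCMField.complexConj L) 2 (Matrix.of fun i j : Fin 2 => if i.val + j.val + 1 = 2 then (1 : L) else 0) × UnitaryGroup.arch (↥(maximalRealSubfield L)) L (IsCMField.complexConj L) 1 (Matrix.of fun i j : Fin 1 => if i.val + j.val + 1 = 1 then (1 : L) else 0))) [νH.IsHaarMeasure] [νH.IsMulRightInvariant]

omit [MeasurableSpace (UnitaryGroup.arch (↥(maximalRealSubfield L)) L (IsCMField.complexConj L) 2 (Matrix.of fun i j : Fin 2 => if i.val + j.val + 1 = 2 then (1 : L) else 0) × UnitaryGroup.arch (↥(maximalRealSubfield L)) L (IsCMField.complexConj L) 1 (Matrix.of fun i j : Fin 1 => if i.val + j.val + 1 = 1 then (1 : L) else 0))] [BorelSpace (UnitaryGroup.arch (↥(maximalRealSubfield L)) L (IsCMField.complexConj L) 2 (Matrix.of fun i j : Fin 2 => if i.val + j.val + 1 = 2 then (1 : L) else 0) × UnitaryGroup.arch (↥(maximalRealSubfield L)) L (IsCMField.complexConj L) 1 (Matrix.of fun i j : Fin 1 => if i.val + j.val + 1 = 1 then (1 : L)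 else 0))] in
include hΦ hνt in
/-- **§1 `ArchCompatibleFamiliesG.transport_archCongr` — PRINT'S MEASURE CONVENTION IS CARRIED BY A CONGRUENCE OF THE INNER FORM.**  Along the frame `Φ : U(H₂)(L ⊗ ℝ) ≃ₜ* U(H)(L ⊗ ℝ)`,
`Φ g = T g T⁻¹`: if `(m₂, m, t₂, t)` is a compatible system for `(U(H₂), U(Φ₃))` w.r.t. the Haar measures `(ν₂, ν)` ((W′)(W)(C′)(C)(C′G) of ★ `ArchCompatibleFamiliesG`), then for
SOME torus datum `t′` on `U(H)` — the push `t′(δ) = (Φ|_{Z(Φ⁻¹δ)})_* t₂(Φ⁻¹ δ)` of ★ `exists_torusPush_archCongr` — the pushed system `(Φ_* m₂, m, t′, t)` (★ `OrbitalMeasureFamily.transport`) is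
compatible for `(U(H), U(Φ₃))` w.r.t. `(Φ_* ν₂, ν)`: (W′) ★ `isQuotientOf_transport_archCongr`, (C′) ★ `map_archStableCentralizerEquiv_torusPush_eq`, (C′G) ★
`map_archStableCentralizerEquiv_torusPush_eq_of_cross` (naturality of the canonical centraliser isomorphisms, ★ p841403), (W)(C) untouched.  Print: «the pair `dt′, ψ_x` defines a
measure `dt` on `T`, independently of the choice of `x`» (Shelstad), «compatible measures» (§1.7).  Borel σ-algebras on the orbit quotients, as in the predicate.
[cite: Rogawski1990, §1.7 p. 6; §4.3 (4.3.1) p. 43; §14.1 p. 232] [cite: Shelstad1979, §4 p. 20] [cite: PlatonovRapinchuk1994, §2.3] -/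
theorem ArchCompatibleFamiliesG.transport_archCongr
    (hanisH : ∀ x : Fin 3 → L, hermForm (cmConjRingHom L) H x x = 0 → x = 0) (hanis₂ : ∀ x : Fin 3 → L, hermForm (cmConjRingHom L) H₂ x x = 0 → x = 0)
    {m₂ : @OrbitalMeasureFamily (UnitaryGroup.arch (↥(maximalRealSubfield L)) L (IsCMField.complexConj L) 3 H₂) _ (fun _ => borel _)}
    {m : @OrbitalMeasureFamily (UnitaryGroup.arch (↥(maximalRealSubfield L)) L (IsCMField.complexConj L) 3 (Matrix.of fun i j : Fin 3 => if i.val + j.val + 1 = 3 then (1 : L) else 0)) _ (fun _ => borel _)}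
    {t₂ : ∀ γ : UnitaryGroup.arch (↥(maximalRealSubfield L)) L (IsCMField.complexConj L) 3 H₂,
      Measure (Subgroup.centralizer ({γ} : Set (UnitaryGroup.arch (↥(maximalRealSubfield L)) L (IsCMField.complexConj L) 3 H₂)))}
    {t : ∀ γ : UnitaryGroup.arch (↥(maximalRealSubfield L)) L (IsCMField.complexConj L) 3 (Matrix.of fun i j : Fin 3 => if i.val + j.val + 1 = 3 then (1 : L) else 0),
      Measure (Subgroup.centralizer ({γ} : Set (UnitaryGroup.arch (↥(maximalRealSubfield L)) L (IsCMField.complexConj L) 3 (Matrix.of fun i j : Fin 3 => if i.val + j.val + 1 = 3 then (1 : L) else 0))))}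
    (hG : ArchCompatibleFamiliesG L H₂ ν₂ ν hanis₂ m₂ m t₂ t) :
    letI : ∀ δ : UnitaryGroup.arch (↥(maximalRealSubfield L)) L (IsCMField.complexConj L) 3 H,
        MeasurableSpace (UnitaryGroup.arch (↥(maximalRealSubfield L)) L (IsCMField.complexConj L) 3 H ⧸ Subgroup.centralizer ({δ} : Set (UnitaryGroup.arch (↥(maximalRealSubfield L)) L (IsCMField.complexConj L) 3 H))) :=
      fun _ => borel _
    haveI : ∀ δ : UnitaryGroup.arch (↥(maximalRealSubfield L)) L (IsCMField.complexConj L) 3 H,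
        BorelSpace (UnitaryGroup.arch (↥(maximalRealSubfield L)) L (IsCMField.complexConj L) 3 H ⧸ Subgroup.centralizer ({δ} : Set (UnitaryGroup.arch (↥(maximalRealSubfield L)) L (IsCMField.complexConj L) 3 H))) :=
      fun _ => ⟨rfl⟩
    letI : ∀ γ : UnitaryGroup.arch (↥(maximalRealSubfield L)) L (IsCMField.complexConj L) 3 H₂,
        MeasurableSpace (UnitaryGroup.arch (↥(maximalRealSubfield L)) L (IsCMField.complexConj L) 3 H₂ ⧸ Subgroup.centralizer ({γ} : Set (UnitaryGroup.arch (↥(maximalRealSubfield L)) L (IsCMField.complexConj L) 3 H₂))) :=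
      fun _ => borel _
    haveI : ∀ γ : UnitaryGroup.arch (↥(maximalRealSubfield L)) L (IsCMField.complexConj L) 3 H₂,
        BorelSpace (UnitaryGroup.arch (↥(maximalRealSubfield L)) L (IsCMField.complexConj L) 3 H₂ ⧸ Subgroup.centralizer ({γ} : Set (UnitaryGroup.arch (↥(maximalRealSubfield L)) L (IsCMField.complexConj L) 3 H₂))) :=
      fun _ => ⟨rfl⟩
    ∃ tp : ∀ δ : UnitaryGroup.arch (↥(maximalRealSubfield L)) L (IsCMField.complexConj L) 3 H,
        Measure (Subgroup.centralizer ({δ} : Set (UnitaryGroup.arch (↥(maximalRealSubfield L)) L (IsCMField.complexConj L) 3 H))),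
      ArchCompatibleFamiliesG L H νt ν hanisH (m₂.transport Φ.toMulEquiv Φ.continuous Φ.symm.continuous) m tp t := by
  -- σ-algebras on the orbit quotients: Borel (the predicate's), named for the transport lemmas
  letI iTm : ∀ δ : UnitaryGroup.arch (↥(maximalRealSubfield L)) L (IsCMField.complexConj L) 3 H, MeasurableSpace (UnitaryGroup.arch (↥(maximalRealSubfield L)) L (IsCMField.complexConj L) 3 H ⧸ Subgroup.centralizer ({δ} : Set (UnitaryGroup.arch (↥(maximalRealSubfield L)) L (IsCMField.complexConj L) 3 H))) := fun _ => borel _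
  haveI iTb : ∀ δ : UnitaryGroup.arch (↥(maximalRealSubfield L)) L (IsCMField.complexConj L) 3 H, BorelSpace (UnitaryGroup.arch (↥(maximalRealSubfield L)) L (IsCMField.complexConj L) 3 H ⧸ Subgroup.centralizer ({δ} : Set (UnitaryGroup.arch (↥(maximalRealSubfield L)) L (IsCMField.complexConj L) 3 H))) := fun _ => ⟨rfl⟩
  letI iSm : ∀ γ : UnitaryGroup.arch (↥(maximalRealSubfield L)) L (IsCMField.complexConj L) 3 H₂, MeasurableSpace (UnitaryGroup.arch (↥(maximalRealSubfield L)) L (IsCMField.complexConj L) 3 H₂ ⧸ Subgroup.centralizer ({γ} : Set (UnitaryGroup.arch (↥(maximalRealSubfield L)) L (IsCMField.complexConj L) 3 H₂))) := fun _ => borel _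
  haveI iSb : ∀ γ : UnitaryGroup.arch (↥(maximalRealSubfield L)) L (IsCMField.complexConj L) 3 H₂, BorelSpace (UnitaryGroup.arch (↥(maximalRealSubfield L)) L (IsCMField.complexConj L) 3 H₂ ⧸ Subgroup.centralizer ({γ} : Set (UnitaryGroup.arch (↥(maximalRealSubfield L)) L (IsCMField.complexConj L) 3 H₂))) := fun _ => ⟨rfl⟩
  obtain ⟨hW₂, hW, hC₂, hC, hCG⟩ := hG
  -- the pushed torus datum (★ `ArchWeilDataCongruence` §1's lambda) and its defining equation
  obtain ⟨tp, htp⟩ := UnitaryGroup.exists_torusPush_archCongr L Φ t₂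
  refine ⟨tp, ?_, hW, ?_, hC, ?_⟩
  · -- (W′) the Weil form of `Φ_* m₂` w.r.t. the pushed torus datum
    exact UnitaryGroup.isQuotientOf_transport_archCongr L (Godement.det_ne_zero_of_anisotropic L H₂ hanis₂) T Φ hΦ t₂ tp htp hW₂ hC₂ νt hνt
  · -- (C′) carried
    exact fun δ₁ δ₂ h₁ hc => UnitaryGroup.map_archStableCentralizerEquiv_torusPush_eq L (Godement.det_ne_zero_of_anisotropic L H hanisH)
      (Godement.det_ne_zero_of_anisotropic L H₂ hanis₂) T Φ hΦ t₂ tp htp hC₂ δ₁ δ₂ h₁ hc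
  · -- (C′G) carried
    exact fun δ γ' h' hc => UnitaryGroup.map_archStableCentralizerEquiv_torusPush_eq_of_cross L (Godement.det_ne_zero_of_anisotropic L H hanisH)
      (Godement.det_ne_zero_of_anisotropic L H₂ hanis₂) (UnitaryGroup.isUnit_antidiagOne_det L 3).ne_zero T Φ hΦ t₂ tp htp t hCG δ γ' h' hc

set_option maxHeartbeats 800000 in
include hΦ hνt in
/-- **§2 THE ENDOSCOPIC TRANSFER LETTER IS CARRIED BY A CONGRUENCE OF THE INNER FORM.**  If ★ `ArchEndoscopicTransferCompatible` holds on `U(H)(L ⊗ ℝ)` for the pushed factor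
`T₂^Φ = T₂.comap Φ⁻¹` (print's «`Δ″_v = Δ_v ∘ ψ_v`») and the pushed Haar measure `Φ_* ν₂` (the SAME `ν` on `U(Φ₃)(L ⊗ ℝ)` and `ν_H` on `H_∞`), then it holds on `U(H₂)(L ⊗ ℝ)` for
`(T₂, ν₂)`: a compatible system `(m₂, m, m_H, t₂, t, t_H)` on the source is pushed by §1 (the `H_∞`-half does not move); for `a₂ ∈ C_c^∞(U(H₂))` the target letter transfers
`a₂ ∘ Φ⁻¹ ∈ C_c^∞(U(H))` (★ `ArchSmooth.comp_archCongr_symm`) to some `a^H ∈ C_c^∞(H_∞)` relative to `(T₂^Φ, Φ_* m₂)`, which IS a `T₂`-transfer of `a₂` relative to `m₂` — «`f′_v → f′_v^H` is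
defined via `f_v = f′_v ∘ ψ_v⁻¹`» (★ `isArchDeltaTransfer_comap_iff`, ★ `TransferFactorData.comap_symm_comap`).  The target's guards `hherm`, `hanis` are the caller's (for a rational
congruence they follow from the source's). [cite: Rogawski1990, §14.4 p. 237; §14.3 pp. 233–234; §4.3 (4.3.1) p. 43; §1.7 p. 6] [cite: PlatonovRapinchuk1994, §2.3] -/
theorem archEndoscopicTransferCompatible_of_archCongr (T₂ : ArchTransferFactor L H₂)
    (hhermH : (H.map (cmConjRingHom L)).transpose = H) (hanisH : ∀ x : Fin 3 → L, hermForm (cmConjRingHom L) H x x = 0 → x = 0)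
    (h : ArchEndoscopicTransferCompatible L H
      (T₂.comap Φ.symm.toMulEquiv (fun γH b hb => (isArchNormPair_archCongr_symm_iff L T Φ hΦ γH b).1 hb)) νt ν νH) :
    ArchEndoscopicTransferCompatible L H₂ T₂ ν₂ ν νH := by
  intro hherm₂ hanis₂ m₂ m mH t₂ t tH hG hH a₂ ha₂
  -- σ-algebras on the orbit quotients: Borel (as fixed inside the predicates), named for the transport lemmas
  letI iTm : ∀ δ : UnitaryGroup.arch (↥(maximalRealSubfield L)) L (IsCMField.complexConj L) 3 H, MeasurableSpace (UnitaryGroup.arch (↥(maximalRealSubfield L)) L (IsCMField.complexConj L) 3 H ⧸ Subgroup.centralizer ({δ} : Set (UnitaryGroup.arch (↥(maximalRealSubfield L)) L (IsCMField.complexConj L) 3 H))) := fun _ => borel _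
  haveI iTb : ∀ δ : UnitaryGroup.arch (↥(maximalRealSubfield L)) L (IsCMField.complexConj L) 3 H, BorelSpace (UnitaryGroup.arch (↥(maximalRealSubfield L)) L (IsCMField.complexConj L) 3 H ⧸ Subgroup.centralizer ({δ} : Set (UnitaryGroup.arch (↥(maximalRealSubfield L)) L (IsCMField.complexConj L) 3 H))) := fun _ => ⟨rfl⟩
  letI iSm : ∀ γ : UnitaryGroup.arch (↥(maximalRealSubfield L)) L (IsCMField.complexConj L) 3 H₂, MeasurableSpace (UnitaryGroup.arch (↥(maximalRealSubfield L)) L (IsCMField.complexConj L) 3 H₂ ⧸ Subgroup.centralizer ({γ} : Set (UnitaryGroup.arch (↥(maximalRealSubfield L)) L (IsCMField.complexConj L) 3 H₂))) := fun _ => borel _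
  haveI iSb : ∀ γ : UnitaryGroup.arch (↥(maximalRealSubfield L)) L (IsCMField.complexConj L) 3 H₂, BorelSpace (UnitaryGroup.arch (↥(maximalRealSubfield L)) L (IsCMField.complexConj L) 3 H₂ ⧸ Subgroup.centralizer ({γ} : Set (UnitaryGroup.arch (↥(maximalRealSubfield L)) L (IsCMField.complexConj L) 3 H₂))) := fun _ => ⟨rfl⟩
  letI iHm : ∀ a : (UnitaryGroup.arch (↥(maximalRealSubfield L)) L (IsCMField.complexConj L) 2 (Matrix.of fun i j : Fin 2 => if i.val + j.val + 1 = 2 then (1 : L) else 0) × UnitaryGroup.arch (↥(maximalRealSubfield L)) L (IsCMField.complexConj L) 1 (Matrix.of fun i j : Fin 1 => if i.val + j.val + 1 = 1 then (1 : L) else 0)),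
      MeasurableSpace ((UnitaryGroup.arch (↥(maximalRealSubfield L)) L (IsCMField.complexConj L) 2 (Matrix.of fun i j : Fin 2 => if i.val + j.val + 1 = 2 then (1 : L) else 0) × UnitaryGroup.arch (↥(maximalRealSubfield L)) L (IsCMField.complexConj L) 1 (Matrix.of fun i j : Fin 1 => if i.val + j.val + 1 = 1 then (1 : L) else 0)) ⧸
        Subgroup.centralizer ({a} : Set (UnitaryGroup.arch (↥(maximalRealSubfield L)) L (IsCMField.complexConj L) 2 (Matrix.of fun i j : Fin 2 => if i.val + j.val + 1 = 2 then (1 : L) else 0) × UnitaryGroup.arch (↥(maximalRealSubfield L)) L (IsCMField.complexConj L) 1 (Matrix.of fun i j : Fin 1 => if i.val + j.val + 1 = 1 then (1 : L) else 0)))) := fun _ => borel _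
  haveI iHb : ∀ a : (UnitaryGroup.arch (↥(maximalRealSubfield L)) L (IsCMField.complexConj L) 2 (Matrix.of fun i j : Fin 2 => if i.val + j.val + 1 = 2 then (1 : L) else 0) × UnitaryGroup.arch (↥(maximalRealSubfield L)) L (IsCMField.complexConj L) 1 (Matrix.of fun i j : Fin 1 => if i.val + j.val + 1 = 1 then (1 : L) else 0)),
      BorelSpace ((UnitaryGroup.arch (↥(maximalRealSubfield L)) L (IsCMField.complexConj L) 2 (Matrix.of fun i j : Fin 2 => if i.val + j.val + 1 = 2 then (1 : L) else 0) × UnitaryGroup.arch (↥(maximalRealSubfield L)) L (IsCMField.complexConj L) 1 (Matrix.of fun i j : Fin 1 => if i.val + j.val + 1 = 1 then (1 : L) else 0)) ⧸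
        Subgroup.centralizer ({a} : Set (UnitaryGroup.arch (↥(maximalRealSubfield L)) L (IsCMField.complexConj L) 2 (Matrix.of fun i j : Fin 2 => if i.val + j.val + 1 = 2 then (1 : L) else 0) × UnitaryGroup.arch (↥(maximalRealSubfield L)) L (IsCMField.complexConj L) 1 (Matrix.of fun i j : Fin 1 => if i.val + j.val + 1 = 1 then (1 : L) else 0)))) := fun _ => ⟨rfl⟩
  -- §1: push the `G′∕G`-half of the system along `Φ`
  obtain ⟨tp, hG'⟩ := ArchCompatibleFamiliesG.transport_archCongr L T Φ hΦ ν₂ νt hνt ν hanisH hanis₂ hG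
  -- the factor round trip `(T₂^Φ) ∘ (id × Φ) = T₂`
  have hTT : (T₂.comap Φ.symm.toMulEquiv (fun γH b hb => (isArchNormPair_archCongr_symm_iff L T Φ hΦ γH b).1 hb)).comap Φ.toMulEquiv
      (isArchNormPair_of_archCongr L T Φ hΦ) = T₂ :=
    TransferFactorData.comap_symm_comap T₂ Φ.toMulEquiv _ _
  -- THE LETTER ON THE TARGET, at the pushed system and the function `a₂ ∘ Φ⁻¹`
  obtain ⟨aH, haH, hrel⟩ := h hhermH hanisH (m₂.transport Φ.toMulEquiv Φ.continuous Φ.symm.continuous) m mH tp t tH hG' hH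
    (a₂ ∘ Φ.symm) (ha₂.comp_archCongr_symm L T Φ hΦ)
  refine ⟨aH, haH, ?_⟩
  -- read (4.3.1) back on the source: «`f_v = f′_v ∘ ψ_v⁻¹`»
  have h5 := (isArchDeltaTransfer_comap_iff L T Φ hΦ
    (T₂.comap Φ.symm.toMulEquiv (fun γH b hb => (isArchNormPair_archCongr_symm_iff L T Φ hΦ γH b).1 hb)) mH m₂ aH a₂).2 hrel
  rw [hTT] at h5
  exact h5

end Transport

/-! ## §3 The explicit factor `Δ″_∞` and the rational diagonalising frame: the HEAD -/

section Diagonal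

/-- `TransferFactorData` is determined by its factor `Δ` (the other fields are propositions). [cite: Rogawski1990, §4.3 p. 43] -/
private theorem transferFactorData_eq_of_Δ_eq {A B : Type*} [Group A] [Group B] {R : A → B → Prop} {T₁ T₂ : TransferFactorData A B R} (h : T₁.Δ = T₂.Δ) :
    T₁ = T₂ := by
  cases T₁; cases T₂; cases h; rfl

/-- **HEAD (N9-DIAG) — `stub_N9` ON EVERY ANISOTROPIC HERMITIAN FORM FROM `stub_N9` ON DIAGONAL FORMS.**  If the archimedean endoscopic transfer letter ★ `ArchEndoscopicTransferCompatible`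
holds for the EXPLICIT factor `Δ″_∞` (★ `archExplicitTransferFactor L H₂ μ hl hr`) and all Haar measures `(ν′, ν, ν_H)` whenever `H₂` is DIAGONAL, then it holds for every `H` — the
statement of the closer's `stub_N9` VERBATIM (binders of `Cruxes/H413/Lines/F0_P3c_StubN9Paydown.lean` `stub_N9_paid`, carriers expanded).  PROOF: the letter's own guards give
`H` hermitian and anisotropic; diagonalise `ᵗ(c̄P) H P = diagonal α` over `L` (★ `exists_formCongr_eq_diagonal`); along `Φ = Ψ_P⁻¹ : U(H) ≃ₜ* U(ᵗc̄PHP)` the pushed factor of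
`Δ″^{H}` is `Δ″^{ᵗc̄PHP}` (★ `archExplicitDelta_archCongr` — `Δ″` is a congruence invariant, print's «`Δ″_v = Δ_v ∘ ψ_v`»), whose invariances `hl`, `hr` follow from those of `H`;
the guards transport (★ `transpose_map_formCongr_cm`, ★ `anisotropic_formCongr_cm`); §2 with the hypothesis at `(ᵗc̄PHP, Φ_* ν′)`.
[cite: Rogawski1990, §14.3 pp. 233–234; §14.4 p. 237; §14.1 p. 232; §1.7 p. 6] [cite: PlatonovRapinchuk1994, §2.3] [cite: Landherr1936HermitianForms] -/
theorem archEndoscopicTransferCompatible_explicit_of_diagonal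
    (hD : ∀ (L : Type) [Field L] [NumberField L] [IsCMField L] (H₂ : Matrix (Fin 3) (Fin 3) L), (∃ α : Fin 3 → L, H₂ = Matrix.diagonal α) →
      ∀ [MeasurableSpace (UnitaryGroup.arch (↥(maximalRealSubfield L)) L (IsCMField.complexConj L) 3 H₂)]
      [BorelSpace (UnitaryGroup.arch (↥(maximalRealSubfield L)) L (IsCMField.complexConj L) 3 H₂)]
      [MeasurableSpace (UnitaryGroup.arch (↥(maximalRealSubfield L)) L (IsCMField.complexConj L) 3 (Matrix.of fun i j : Fin 3 => if i.val + j.val + 1 = 3 then (1 : L) else 0))]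
      [BorelSpace (UnitaryGroup.arch (↥(maximalRealSubfield L)) L (IsCMField.complexConj L) 3 (Matrix.of fun i j : Fin 3 => if i.val + j.val + 1 = 3 then (1 : L) else 0))]
      [MeasurableSpace (UnitaryGroup.arch (↥(maximalRealSubfield L)) L (IsCMField.complexConj L) 2 (Matrix.of fun i j : Fin 2 => if i.val + j.val + 1 = 2 then (1 : L) else 0) ×
          UnitaryGroup.arch (↥(maximalRealSubfield L)) L (IsCMField.complexConj L) 1 (Matrix.of fun i j : Fin 1 => if i.val + j.val + 1 = 1 then (1 : L) else 0))]
      [BorelSpace (UnitaryGroup.arch (↥(maximalRealSubfield L)) L (IsCMField.complexConj L) 2 (Matrix.of fun i j : Fin 2 => if i.val + j.val + 1 = 2 then (1 : L) else 0) ×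
          UnitaryGroup.arch (↥(maximalRealSubfield L)) L (IsCMField.complexConj L) 1 (Matrix.of fun i j : Fin 1 => if i.val + j.val + 1 = 1 then (1 : L) else 0))]
      (ν' : Measure (UnitaryGroup.arch (↥(maximalRealSubfield L)) L (IsCMField.complexConj L) 3 H₂))
      (ν : Measure (UnitaryGroup.arch (↥(maximalRealSubfield L)) L (IsCMField.complexConj L) 3 (Matrix.of fun i j : Fin 3 => if i.val + j.val + 1 = 3 then (1 : L) else 0)))
      (νH : Measure (UnitaryGroup.arch (↥(maximalRealSubfield L)) L (IsCMField.complexConj L) 2 (Matrix.of fun i j : Fin 2 => if i.val + j.val + 1 = 2 then (1 : L) else 0) ×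
          UnitaryGroup.arch (↥(maximalRealSubfield L)) L (IsCMField.complexConj L) 1 (Matrix.of fun i j : Fin 1 => if i.val + j.val + 1 = 1 then (1 : L) else 0)))
      [ν'.IsHaarMeasure] [ν'.IsMulRightInvariant] [ν.IsHaarMeasure] [ν.IsMulRightInvariant] [νH.IsHaarMeasure] [νH.IsMulRightInvariant]
      (μ : HeckeCharacter L) (_hμu : μ.IsUnitary)
      (_hμω : ∀ x : Literature.NumberTheory.GaloisRepresentations.ideleGroup ↥(maximalRealSubfield L), μ (AdeleRing.ideleBaseChange (↥(maximalRealSubfield L)) L x) = quadraticHeckeCharCM L x)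
      (hl : ∀ (a : UnitaryGroup.arch (↥(maximalRealSubfield L)) L (IsCMField.complexConj L) 2 (Matrix.of fun i j : Fin 2 => if i.val + j.val + 1 = 2 then (1 : L) else 0) ×
            UnitaryGroup.arch (↥(maximalRealSubfield L)) L (IsCMField.complexConj L) 1 (Matrix.of fun i j : Fin 1 => if i.val + j.val + 1 = 1 then (1 : L) else 0))
          (b : UnitaryGroup.arch (↥(maximalRealSubfield L)) L (IsCMField.complexConj L) 3 H₂)
          (x : UnitaryGroup.arch (↥(maximalRealSubfield L)) L (IsCMField.complexConj L) 2 (Matrix.of fun i j : Fin 2 => if i.val + j.val + 1 = 2 then (1 : L) else 0) ×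
            UnitaryGroup.arch (↥(maximalRealSubfield L)) L (IsCMField.complexConj L) 1 (Matrix.of fun i j : Fin 1 => if i.val + j.val + 1 = 1 then (1 : L) else 0)),
          archExplicitDelta L H₂ (x * a * x⁻¹) μ b = archExplicitDelta L H₂ a μ b)
      (hr : ∀ (a : UnitaryGroup.arch (↥(maximalRealSubfield L)) L (IsCMField.complexConj L) 2 (Matrix.of fun i j : Fin 2 => if i.val + j.val + 1 = 2 then (1 : L) else 0) ×
            UnitaryGroup.arch (↥(maximalRealSubfield L)) L (IsCMField.complexConj L) 1 (Matrix.of fun i j : Fin 1 => if i.val + j.val + 1 = 1 then (1 : L) else 0))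
          (b y : UnitaryGroup.arch (↥(maximalRealSubfield L)) L (IsCMField.complexConj L) 3 H₂),
          archExplicitDelta L H₂ a μ (y * b * y⁻¹) = archExplicitDelta L H₂ a μ b),
      ArchEndoscopicTransferCompatible L H₂ (archExplicitTransferFactor L H₂ μ hl hr) ν' ν νH) :
    ∀ (L : Type) [Field L] [NumberField L] [IsCMField L] (H : Matrix (Fin 3) (Fin 3) L)
      [MeasurableSpace (UnitaryGroup.arch (↥(maximalRealSubfield L)) L (IsCMField.complexConj L) 3 H)]
      [BorelSpace (UnitaryGroup.arch (↥(maximalRealSubfield L)) L (IsCMField.complexConj L) 3 H)]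
      [MeasurableSpace (UnitaryGroup.arch (↥(maximalRealSubfield L)) L (IsCMField.complexConj L) 3 (Matrix.of fun i j : Fin 3 => if i.val + j.val + 1 = 3 then (1 : L) else 0))]
      [BorelSpace (UnitaryGroup.arch (↥(maximalRealSubfield L)) L (IsCMField.complexConj L) 3 (Matrix.of fun i j : Fin 3 => if i.val + j.val + 1 = 3 then (1 : L) else 0))]
      [MeasurableSpace (UnitaryGroup.arch (↥(maximalRealSubfield L)) L (IsCMField.complexConj L) 2 (Matrix.of fun i j : Fin 2 => if i.val + j.val + 1 = 2 then (1 : L) else 0) ×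
          UnitaryGroup.arch (↥(maximalRealSubfield L)) L (IsCMField.complexConj L) 1 (Matrix.of fun i j : Fin 1 => if i.val + j.val + 1 = 1 then (1 : L) else 0))]
      [BorelSpace (UnitaryGroup.arch (↥(maximalRealSubfield L)) L (IsCMField.complexConj L) 2 (Matrix.of fun i j : Fin 2 => if i.val + j.val + 1 = 2 then (1 : L) else 0) ×
          UnitaryGroup.arch (↥(maximalRealSubfield L)) L (IsCMField.complexConj L) 1 (Matrix.of fun i j : Fin 1 => if i.val + j.val + 1 = 1 then (1 : L) else 0))]
      (ν' : Measure (UnitaryGroup.arch (↥(maximalRealSubfield L)) L (IsCMField.complexConj L) 3 H))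
      (ν : Measure (UnitaryGroup.arch (↥(maximalRealSubfield L)) L (IsCMField.complexConj L) 3 (Matrix.of fun i j : Fin 3 => if i.val + j.val + 1 = 3 then (1 : L) else 0)))
      (νH : Measure (UnitaryGroup.arch (↥(maximalRealSubfield L)) L (IsCMField.complexConj L) 2 (Matrix.of fun i j : Fin 2 => if i.val + j.val + 1 = 2 then (1 : L) else 0) ×
          UnitaryGroup.arch (↥(maximalRealSubfield L)) L (IsCMField.complexConj L) 1 (Matrix.of fun i j : Fin 1 => if i.val + j.val + 1 = 1 then (1 : L) else 0)))
      [ν'.IsHaarMeasure] [ν'.IsMulRightInvariant] [ν.IsHaarMeasure] [ν.IsMulRightInvariant] [νH.IsHaarMeasure] [νH.IsMulRightInvariant]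
      (μ : HeckeCharacter L) (_hμu : μ.IsUnitary)
      (_hμω : ∀ x : Literature.NumberTheory.GaloisRepresentations.ideleGroup ↥(maximalRealSubfield L), μ (AdeleRing.ideleBaseChange (↥(maximalRealSubfield L)) L x) = quadraticHeckeCharCM L x)
      (hl : ∀ (a : UnitaryGroup.arch (↥(maximalRealSubfield L)) L (IsCMField.complexConj L) 2 (Matrix.of fun i j : Fin 2 => if i.val + j.val + 1 = 2 then (1 : L) else 0) ×
            UnitaryGroup.arch (↥(maximalRealSubfield L)) L (IsCMField.complexConj L) 1 (Matrix.of fun i j : Fin 1 => if i.val + j.val + 1 = 1 then (1 : L) else 0))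
          (b : UnitaryGroup.arch (↥(maximalRealSubfield L)) L (IsCMField.complexConj L) 3 H)
          (x : UnitaryGroup.arch (↥(maximalRealSubfield L)) L (IsCMField.complexConj L) 2 (Matrix.of fun i j : Fin 2 => if i.val + j.val + 1 = 2 then (1 : L) else 0) ×
            UnitaryGroup.arch (↥(maximalRealSubfield L)) L (IsCMField.complexConj L) 1 (Matrix.of fun i j : Fin 1 => if i.val + j.val + 1 = 1 then (1 : L) else 0)),
          archExplicitDelta L H (x * a * x⁻¹) μ b = archExplicitDelta L H a μ b)
      (hr : ∀ (a : UnitaryGroup.arch (↥(maximalRealSubfield L)) L (IsCMField.complexConj L) 2 (Matrix.of fun i j : Fin 2 => if i.val + j.val + 1 = 2 then (1 : L) else 0) ×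
            UnitaryGroup.arch (↥(maximalRealSubfield L)) L (IsCMField.complexConj L) 1 (Matrix.of fun i j : Fin 1 => if i.val + j.val + 1 = 1 then (1 : L) else 0))
          (b y : UnitaryGroup.arch (↥(maximalRealSubfield L)) L (IsCMField.complexConj L) 3 H),
          archExplicitDelta L H a μ (y * b * y⁻¹) = archExplicitDelta L H a μ b),
      ArchEndoscopicTransferCompatible L H (archExplicitTransferFactor L H μ hl hr) ν' ν νH := by
  intro L _ _ _ H _ _ _ _ _ _ ν' ν νH _ _ _ _ _ _ μ hμu hμω hl hr hherm hanis
  -- a rational diagonalising frame (the letter's own guards make `H` hermitian anisotropic)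
  obtain ⟨P, α, hP⟩ := exists_formCongr_eq_diagonal L H hherm hanis
  -- the arch congruence `Ψ : U(ᵗc̄P H P)(L ⊗ ℝ) ≃ₜ* U(H)(L ⊗ ℝ)` and the abstract frame of its inverse `Φ = Ψ⁻¹`, `T = (P ⊗ 1)⁻¹`
  let Ψ : UnitaryGroup.arch (↥(maximalRealSubfield L)) L (IsCMField.complexConj L) 3 (formCongr (cmConjRingHom L) P H) ≃ₜ* UnitaryGroup.arch (↥(maximalRealSubfield L)) L (IsCMField.complexConj L) 3 H :=
    unitaryGroupOfFormCongrOfEq (UnitaryGroup.conjMixed (↥(maximalRealSubfield L)) L (IsCMField.complexConj L))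
      (Matrix.GeneralLinearGroup.map (mixedEmbedding L) P) (UnitaryGroup.archFormOf L 3 H) _ (UnitaryGroup.archFormOf_formCongr L P H).symm
  have hΨ : ∀ g : UnitaryGroup.arch (↥(maximalRealSubfield L)) L (IsCMField.complexConj L) 3 (formCongr (cmConjRingHom L) P H),
      ((Ψ g : UnitaryGroup.arch (↥(maximalRealSubfield L)) L (IsCMField.complexConj L) 3 H) : GL (Fin 3) (mixedSpace L)) =
        Matrix.GeneralLinearGroup.map (mixedEmbedding L) P * (g : GL (Fin 3) (mixedSpace L)) * (Matrix.GeneralLinearGroup.map (mixedEmbedding L) P)⁻¹ :=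
    fun g => UnitaryGroup.coe_archCongr_apply L P H g
  have hΦ : ∀ g : UnitaryGroup.arch (↥(maximalRealSubfield L)) L (IsCMField.complexConj L) 3 H,
      ((Ψ.symm g : UnitaryGroup.arch (↥(maximalRealSubfield L)) L (IsCMField.complexConj L) 3 (formCongr (cmConjRingHom L) P H)) : GL (Fin 3) (mixedSpace L)) =
        (Matrix.GeneralLinearGroup.map (mixedEmbedding L) P)⁻¹ * (g : GL (Fin 3) (mixedSpace L)) * (Matrix.GeneralLinearGroup.map (mixedEmbedding L) P)⁻¹⁻¹ :=
    fun g => by rw [inv_inv]; exact UnitaryGroup.coe_archCongr_symm_apply L P H g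
  -- σ-algebras and the pushed Haar measure on the congruent group
  letI : MeasurableSpace (UnitaryGroup.arch (↥(maximalRealSubfield L)) L (IsCMField.complexConj L) 3 (formCongr (cmConjRingHom L) P H)) := borel _
  haveI : BorelSpace (UnitaryGroup.arch (↥(maximalRealSubfield L)) L (IsCMField.complexConj L) 3 (formCongr (cmConjRingHom L) P H)) := ⟨rfl⟩
  haveI h1 : (ν'.map Ψ.symm).IsHaarMeasure := ContinuousMulEquiv.isHaarMeasure_map ν' Ψ.symm
  haveI h2 : (ν'.map Ψ.symm).IsMulRightInvariant := isMulRightInvariant_map_mulEquiv_of_isMulRightInvariant Ψ.symm.toMulEquiv Ψ.symm.continuous.measurable ν'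
  -- the guards and the factor's two invariances transport along `P`
  have hherm₂ := UnitaryGroup.transpose_map_formCongr_cm L P hherm
  have hanis₂ := UnitaryGroup.anisotropic_formCongr_cm L P hanis
  have hT : formCongr (UnitaryGroup.conjMixed (↥(maximalRealSubfield L)) L (IsCMField.complexConj L)) (Matrix.GeneralLinearGroup.map (mixedEmbedding L) P)
      (UnitaryGroup.archFormOf L 3 H) = UnitaryGroup.archFormOf L 3 (formCongr (cmConjRingHom L) P H) :=
    (UnitaryGroup.archFormOf_formCongr L P H).symm
  have hΔ : ∀ (a : UnitaryGroup.arch (↥(maximalRealSubfield L)) L (IsCMField.complexConj L) 2 (Matrix.of fun i j : Fin 2 => if i.val + j.val + 1 = 2 then (1 : L) else 0) ×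
        UnitaryGroup.arch (↥(maximalRealSubfield L)) L (IsCMField.complexConj L) 1 (Matrix.of fun i j : Fin 1 => if i.val + j.val + 1 = 1 then (1 : L) else 0))
      (g : UnitaryGroup.arch (↥(maximalRealSubfield L)) L (IsCMField.complexConj L) 3 (formCongr (cmConjRingHom L) P H)),
      archExplicitDelta L H a μ (Ψ g) = archExplicitDelta L (formCongr (cmConjRingHom L) P H) a μ g :=
    fun a g => archExplicitDelta_archCongr L (Matrix.GeneralLinearGroup.map (mixedEmbedding L) P) Ψ hΨ hT a μ g
  have hl₂ : ∀ (a : UnitaryGroup.arch (↥(maximalRealSubfield L)) L (IsCMField.complexConj L) 2 (Matrix.of fun i j : Fin 2 => if i.val + j.val + 1 = 2 then (1 : L) else 0) ×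
        UnitaryGroup.arch (↥(maximalRealSubfield L)) L (IsCMField.complexConj L) 1 (Matrix.of fun i j : Fin 1 => if i.val + j.val + 1 = 1 then (1 : L) else 0))
      (b : UnitaryGroup.arch (↥(maximalRealSubfield L)) L (IsCMField.complexConj L) 3 (formCongr (cmConjRingHom L) P H))
      (x : UnitaryGroup.arch (↥(maximalRealSubfield L)) L (IsCMField.complexConj L) 2 (Matrix.of fun i j : Fin 2 => if i.val + j.val + 1 = 2 then (1 : L) else 0) ×
        UnitaryGroup.arch (↥(maximalRealSubfield L)) L (IsCMField.complexConj L) 1 (Matrix.of fun i j : Fin 1 => if i.val + j.val + 1 = 1 then (1 : L) else 0)),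
      archExplicitDelta L (formCongr (cmConjRingHom L) P H) (x * a * x⁻¹) μ b = archExplicitDelta L (formCongr (cmConjRingHom L) P H) a μ b := fun a b x => by
    rw [← hΔ, ← hΔ]; exact hl a (Ψ b) x
  have hr₂ : ∀ (a : UnitaryGroup.arch (↥(maximalRealSubfield L)) L (IsCMField.complexConj L) 2 (Matrix.of fun i j : Fin 2 => if i.val + j.val + 1 = 2 then (1 : L) else 0) ×
        UnitaryGroup.arch (↥(maximalRealSubfield L)) L (IsCMField.complexConj L) 1 (Matrix.of fun i j : Fin 1 => if i.val + j.val + 1 = 1 then (1 : L) else 0))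
      (b y : UnitaryGroup.arch (↥(maximalRealSubfield L)) L (IsCMField.complexConj L) 3 (formCongr (cmConjRingHom L) P H)),
      archExplicitDelta L (formCongr (cmConjRingHom L) P H) a μ (y * b * y⁻¹) = archExplicitDelta L (formCongr (cmConjRingHom L) P H) a μ b := fun a b y => by
    rw [← hΔ, ← hΔ, map_mul, map_mul, map_inv]; exact hr a (Ψ b) (Ψ y)
  -- the pushed factor of `Δ″^{H}` along `Φ = Ψ⁻¹` IS `Δ″^{ᵗc̄PHP}`
  have hfac : (archExplicitTransferFactor L H μ hl hr).comap Ψ.symm.symm.toMulEquiv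
      (fun γH b hb => (isArchNormPair_archCongr_symm_iff L _ Ψ.symm hΦ γH b).1 hb) =
      archExplicitTransferFactor L (formCongr (cmConjRingHom L) P H) μ hl₂ hr₂ := by
    refine transferFactorData_eq_of_Δ_eq (funext fun a => funext fun g => ?_)
    show archExplicitDelta L H a μ (Ψ.symm.symm g) = archExplicitDelta L (formCongr (cmConjRingHom L) P H) a μ g
    rw [ContinuousMulEquiv.symm_symm]
    exact hΔ a g
  -- §2 along `Φ = Ψ⁻¹`, with the hypothesis on the congruent (diagonal) form
  refine (archEndoscopicTransferCompatible_of_archCongr L _ Ψ.symm hΦ ν' (ν'.map Ψ.symm) rfl ν νH (archExplicitTransferFactor L H μ hl hr) hherm₂ hanis₂ ?_)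
    hherm hanis
  rw [hfac]
  exact hD L (formCongr (cmConjRingHom L) P H) ⟨α, hP⟩ (ν'.map Ψ.symm) ν νH μ hμu hμω hl₂ hr₂

end Diagonal

end Literature.NumberTheory.Rogawski1990

end
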